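import Summits.AnomalousDissipation.AnomalousDissipation.Theses.LimitingAbsorption

/-!
# Sketch — crux ideas for `RelaxationBoundsInventory` (stmt-AnomalousDissipation-2940), ideator 2

First-lemma signatures of the two idea cards (defs only; nothing is proved here):

* card `adjoint-mollified-duality`: `AdjointTestIdentity` (entry identity of the line) and the
  transfer target `FiniteHorizonInventory` (finite-horizon, every-`T` inventory bound), with the
  routine implication `FiniteHorizonInventory → RelaxationBoundsInventory` recorded as a `Prop`.
* card `phase-continuous-releases`: `ReleaseContinuityAtZero` (phase-uniform modulus of
  continuity of releases at age `0⁺`) and `WeakRestartAE` (cocycle / restart of weak scalars).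
-/

noncomputable section

open MeasureTheory Set Filter
open scoped InnerProductSpace ENNReal NNReal

namespace Summit.AnomalousDissipation.AnomalousDissipation.Cruxes.RelaxationBoundsInventory.Sketch

set_option linter.dupNamespace false

open Literature.Analysis Literature.Analysis.FluidPDE Literature.Analysis.FluidPDE.Torus
open Literature.Analysis.FunctionSpaces.Torus

local notation "𝕋²" => UnitAddTorus (Fin 2)
local notation "E²" => EuclideanSpace ℝ (Fin 2)

/-- Card 1, first lemma. **Adjoint test identity with a smooth surrogate drift.** Let `Ψ` be a
globally smooth space–time field vanishing for `t ≥ T' < T` and solving POINTWISE ON `(0,T)` the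
backward sourced equation `∂ₜΨ + w·∇Ψ + κΔΨ = -Φ` for a smooth surrogate drift `w` (outside `(0,T)`
`Ψ` is only a smooth cutoff extension; the weak identities integrate over `(0,T)` only) (in the line: `w` = a
space–time mollification of `u`, `Ψ` = the classical solution given by
`exists_unique_isClassicalScalarTransportForcedOn_holds` after time reversal). Then every weak
solution of the `h`-sourced problem from zero datum satisfies
`∫∫ θ Φ = ∫∫ h Ψ + ∫∫ θ ⟪u - w, ∇Ψ⟫`: the weak identity tested with `ψ := Ψ`, which is an
admissible `IsSpaceTimeTest T`. -/
def AdjointTestIdentity : Prop :=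
  ∀ (κ T T' : ℝ) (u w : ℝ → 𝕋² → E²) (h : 𝕋² → ℝ) (Φ Ψ θ : ℝ → 𝕋² → ℝ),
    T' < T →
    ContDiff ℝ ((⊤ : ℕ∞) : WithTop ℕ∞) (stLift Ψ) → (∀ t, T' ≤ t → Ψ t = 0) →
    ContDiff ℝ ((⊤ : ℕ∞) : WithTop ℕ∞) (stLift w) → ContDiff ℝ ((⊤ : ℕ∞) : WithTop ℕ∞) (stLift Φ) →
    (∀ t ∈ Ioo (0 : ℝ) T, ∀ x,
      FunctionSpaces.Torus.timeDeriv Ψ t x + ⟪w t x, gradient (Ψ t) x⟫_ℝ + κ * laplacian (Ψ t) x = -Φ t x) →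
    IsWeakScalarTransportForcedOn T κ u (fun _ => h) 0 θ →
    ∫ t in Ioo 0 T, ∫ x, θ t x * Φ t x =
      (∫ t in Ioo 0 T, ∫ x, h x * Ψ t x) +
        ∫ t in Ioo 0 T, ∫ x, θ t x * ⟪u t x - w t x, gradient (Ψ t) x⟫_ℝ

/-- Card 1, companion identity for a RELEASE at phase `τ ∈ [0,T)` (same `Ψ`, `Φ`, `w`): testing the
homogeneous weak identity of `Θ` (drift `u(τ+·)`, datum `h`, horizon `T - τ`) with `Ψ(τ + ·)`
gives `∫ h Ψ(τ) = ∫∫ Θ(σ) Φ(τ+σ) - ∫∫ Θ(σ) ⟪(u - w)(τ+σ), ∇Ψ(τ+σ)⟫`. -/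
def ReleaseTestIdentity : Prop :=
  ∀ (κ T T' τ : ℝ) (u w : ℝ → 𝕋² → E²) (h : 𝕋² → ℝ) (Φ Ψ Θ : ℝ → 𝕋² → ℝ),
    T' < T → 0 ≤ τ → τ < T →
    ContDiff ℝ ((⊤ : ℕ∞) : WithTop ℕ∞) (stLift Ψ) → (∀ t, T' ≤ t → Ψ t = 0) →
    ContDiff ℝ ((⊤ : ℕ∞) : WithTop ℕ∞) (stLift w) → ContDiff ℝ ((⊤ : ℕ∞) : WithTop ℕ∞) (stLift Φ) →
    (∀ t ∈ Ioo (0 : ℝ) T, ∀ x,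
      FunctionSpaces.Torus.timeDeriv Ψ t x + ⟪w t x, gradient (Ψ t) x⟫_ℝ + κ * laplacian (Ψ t) x = -Φ t x) →
    IsWeakScalarTransportOn (T - τ) κ (fun σ => u (τ + σ)) h Θ →
    ∫ x, h x * Ψ τ x =
      (∫ σ in Ioo 0 (T - τ), ∫ x, Θ σ x * Φ (τ + σ) x) -
        ∫ σ in Ioo 0 (T - τ), ∫ x, Θ σ x * ⟪u (τ + σ) x - w (τ + σ) x, gradient (Ψ (τ + σ)) x⟫_ℝ

/-- Card 1, transfer target `C⁺`. **Finite-horizon inventory bound, every horizon**: under the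
hypotheses of the crux, `∫₀ᵀ ‖θ(t)‖² dt ≤ (4C/γ²) ‖h‖² · T` for EVERY `T > 0` and every weak
solution of the sourced problem on `[0,T)` from zero datum. Strictly stronger than the crux
(Cesàro `limsup`), and what the duality line proves natively. -/
def FiniteHorizonInventory : Prop :=
  ∀ (κ : ℝ) (u : ℝ → 𝕋² → E²) (h : 𝕋² → ℝ) (C γ : ℝ), 0 < κ → 0 ≤ C → 0 < γ →
    MemLp h 2 volume →
    (∀ T : ℝ, 0 < T → MemLp (stLift u) ⊤ (volume.restrict (Ioo (0 : ℝ) T ×ˢ univ))) →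
    (∀ s : ℝ, 0 ≤ s → ∀ (T : ℝ) (θ : ℝ → 𝕋² → ℝ),
      IsWeakScalarTransportOn T κ (fun t => u (s + t)) h θ →
        ∀ᵐ t ∂(volume.restrict (Ioo (0 : ℝ) T)),
          scalarL2Sq (θ t) ≤ C * Real.exp (-(γ * t)) * scalarL2Sq h) →
    ∀ (T : ℝ) (θ : ℝ → 𝕋² → ℝ), 0 < T → IsWeakScalarTransportForcedOn T κ u (fun _ => h) 0 θ →
      ∫ t in Ioo 0 T, scalarL2Sq (θ t) ≤ 4 * C / γ ^ 2 * scalarL2Sq h * T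

/-- The transfer is honest: `C⁺ →` the crux as filed (time means `≤ 4C/γ² ‖h‖²` for every `T > 0`
bound the `limsup`; `timeMean` is an interval integral over `(0,T)`). Routine. -/
def Transfer : Prop :=
  FiniteHorizonInventory →
    Summit.AnomalousDissipation.AnomalousDissipation.Theses.LimitingAbsorption.RelaxationBoundsInventory

/-- Card 2, first lemma. **Releases leave the profile continuously, uniformly in the phase.**
For a drift essentially bounded by `M` on `(0,T) × T²` (in the line: the shifted drift
`u(s + ·)`, so the modulus below is the same for every phase `s`), `κ > 0`, `h ∈ L²` and ANY smooth
comparison profile `g`, every weak solution from datum `h` satisfies, for a.e. `σ ∈ (0,T)`,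
`‖Θ(σ) - h‖² ≤ 2σ‖h‖(M‖∇g‖ + κ‖Δg‖) + 4‖h‖ ‖h - g‖` (`L²` contraction + the steady-test
identity `PassiveScalarSteadyTest.ae_integral_mul_eq` with test `g`). -/
def ReleaseContinuityAtZero : Prop :=
  ∀ (κ T M : ℝ) (u : ℝ → 𝕋² → E²) (h g : 𝕋² → ℝ) (Θ : ℝ → 𝕋² → ℝ),
    0 < κ → 0 < T → 0 ≤ M → MemLp h 2 volume → IsSmooth g →
    eLpNorm (stLift u) ⊤ (volume.restrict (Ioo (0 : ℝ) T ×ˢ univ)) ≤ ENNReal.ofReal M →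
    IsWeakScalarTransportOn T κ u h Θ →
    ∀ᵐ σ ∂(volume.restrict (Ioo (0 : ℝ) T)),
      scalarL2Sq (fun x => Θ σ x - h x) ≤
        2 * σ * Real.sqrt (scalarL2Sq h) *
            (M * Real.sqrt (scalarGradNormSq g) + κ * Real.sqrt (scalarL2Sq (laplacian g))) +
          4 * Real.sqrt (scalarL2Sq h) * Real.sqrt (scalarL2Sq (fun x => h x - g x))

/-- Card 2, second ingredient. **Restart (cocycle) of weak scalars at a.e. time** for bounded
drift and `κ > 0`: the tail `τ ↦ Θ(t₁ + τ)` is a weak solution with the shifted drift from datum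
`Θ(t₁)`, for a.e. `t₁` (every `t₁` for the weakly continuous representative, which is the form
the line uses and which crux r5 `ScalarSectorLift` needs anyway). -/
def WeakRestartAE : Prop :=
  ∀ (κ T : ℝ) (u : ℝ → 𝕋² → E²) (θ₀ : 𝕋² → ℝ) (Θ : ℝ → 𝕋² → ℝ),
    0 < κ → MemLp θ₀ 2 volume →
    MemLp (stLift u) ⊤ (volume.restrict (Ioo (0 : ℝ) T ×ˢ univ)) →
    IsWeakScalarTransportOn T κ u θ₀ Θ →
    ∀ᵐ t₁ ∂(volume.restrict (Ioo (0 : ℝ) T)),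
      IsWeakScalarTransportOn (T - t₁) κ (fun τ => u (t₁ + τ)) (Θ t₁) (fun τ => Θ (t₁ + τ))

end Summit.AnomalousDissipation.AnomalousDissipation.Cruxes.RelaxationBoundsInventory.Sketch

end
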